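import Literature.LinearAlgebra.Matrix.PermanentSubpermTools
import Mathlib.Algebra.BigOperators.Ring.Finset
import Mathlib.Data.Fintype.Pi
import Mathlib.Tactic.DeriveFintype
import Mathlib.Tactic.LinearCombination
import Mathlib.Algebra.MvPolynomial.CommRing
import Mathlib.Data.Fintype.BigOperators
import HarnessLib

/-!
# A read-once permanent computing every multilinear polynomial (Hrubeš–Joglekar 2025, Thm. 3)

Hrubeš–Joglekar, *On read-k projections of the determinant* (STACS 2025), Thm. 3: over a field
of characteristic `≠ 2`, every multilinear `f ∈ 𝔽[x_1, …, x_k]` is the permanent of a matrix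
of size `O(2^k)` over `𝔽 ∪ {x_i}` in which every `x_i` occurs exactly once, and in its own row
and column. This is the property of the permanent that drives the counting argument of their
Thm. 7 (variable size `Ω(n^{5/2}/log n)` for determinantal representations of `perm_n`): every
multilinear polynomial in `k = log₂ n - O(1)` well-placed variables of the `n × n` permanent is
obtained from `perm_n` by substituting constants for the other variables.

The printed proof goes through Valiant's `VNP`-completeness machinery (their Lemmas 4–6 =
Bürgisser–Clausen–Shokrollahi (21.27), (21.29) plus a formula for `f̂ · ∏ (x_i y_i + 1 - y_i)`).
The tree's discharges of (21.27)/(21.29) (`PermanentUniversality.lean`, `PermanentBooleanSum.lean`)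
do not record the number of occurrences of the `x_i` nor the row property, so we prove the
needed statement DIRECTLY, by an explicit gadget of size `3 (2^{k+1} - 1) + k` whose permanent we
compute in closed form. This file is that computation; the application to Thm. 7 is in
`ReadKDeterminantalRepresentationsProofs.lean`.

## The gadget (`ReadOnceTree.treeMatrix`)

Vertices (`ReadOnceTree.V k`): the nodes `ν` of the complete binary tree of depth `k`
(`ReadOnceTree.Node k`: depth `d ≤ k` and the bit string of the path from the root), for every
node two *absorbers* `m_ν`, `m'_ν`, and `k` *variable vertices* `u_0, …, u_{k-1}`. Weights
(`ReadOnceTree.wt`, successor convention; the matrix entry `(r, c)` is the weight of `c → r`):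
for a node `ν` of depth `d < k` with children `ν0`, `ν1`:
`ν → ν0`, `ν → m_ν`, `m_ν → ν1`, `m_ν ⇄ u_d`, `u_d → m'_ν`, `m'_ν → u_d` of weight `1`,
`m'_ν → ν1` of weight `-1`; loops of weight `1` on all non-root nodes and all absorbers; the loop
`z_d` on `u_d`; and for every leaf `λ` the edge `λ → root` of weight `y_λ`. So `z_d` occurs once
(a diagonal entry) and `y_λ` once.

## The computation (`ReadOnceTree.permanent_treeMatrix`)

`per = ∑_{g ∈ {0,1}^k} y_g ∏_{i<k} (z_i + K_i - 2 g_i)`, `K_i = 2 · 2^i` the number of absorbers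
of depth `i` (`levelConst`; only its role as a constant matters). A cycle cover consists of ONE
cycle through the root — it descends one level at a time and returns from a leaf — together
with loops and `2`-cycles `u_d ⇄ absorber`. At a node `ν` of depth `d` the cycle either goes to
`ν0` (then `u_d` takes its loop `z_d` or pairs with one of the `K_d` absorbers: factor
`z_d + K_d`), or to `m_ν` and on to `ν1` (factor `z_d + K_d - 1`: `m_ν` is busy), or to `m_ν`,
`u_d` and then to an absorber `m_μ` (`μ ≠ ν`, continuing at `μ1`, weight `+1`) or `m'_μ` (any
`μ`, continuing at `μ1`, weight `-1`): these last contributions cancel in pairs except `-S(ν1)`,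
giving the factor `z_d + K_d - 2` for the branch to `ν1` — the memory of the position `ν` is
kept although `u_d` is shared by the whole level. Formally: `pathSub μ` is the subpermanent
(`Matrix.subperm`) "below `μ`"; `pathSub_leaf`, `pathSub_step` (column expansions
`Matrix.subperm_col_one/_col_two/_expand_col_support`, the exact Laplace splitting
`Matrix.subperm_laplace_exact` between the deeper levels and the idle block of depth `d`, and the
idle blocks `subperm_level_eq_one`, `subperm_level_eq` via the ranked-diagonal lemma), then
`pathSub_eq` by induction on the height and `permanent_treeMatrix`.

## Prescribing the coefficients (`ReadOnceTree.exists_permanent_treeMatrix_eq`)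

With `z_i = X_i` and constant `y_g`, the coefficient of the multilinear monomial `X^s` is
`∑_g y_g ∏_i coefBlock K_i s_i g_i` (`permanent_treeMatrix_C_X`); the coefficient matrix is the
tensor product of the `2 × 2` blocks `((K_i, K_i - 2), (1, 1))` of determinant `2`, so when `2`
is invertible every family of `2^k` coefficients is attained (`invBlock`,
`sum_coefBlock_mul_invBlock`, `exists_permanent_treeMatrix_eq`). This is exactly where
characteristic `≠ 2` enters (in characteristic `2` the statement is false: `per = det` and
Hrubeš–Joglekar Thm. 2).

## References

* P. Hrubeš, P. S. Joglekar, *On read-k projections of the determinant*, STACS 2025, LIPIcs 327,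
  Art. 53, doi:10.4230/LIPIcs.STACS.2025.53: Thm. 3 (p. 53:4) and its use in the proof of
  Thm. 7 (p. 53:6, with footnote 3). The gadget and its analysis here are ours (a different,
  shorter road to the consequence of Thm. 3 that Thm. 7 uses); brute-force checked for `k ≤ 3`.
* L. G. Valiant, *Completeness classes in algebra*, STOC 1979 (iff-couplings by cancellation in
  characteristic `≠ 2`, the idea behind the signed absorbers).
-/

namespace Literature.Computability.AlgebraicComplexity

open Matrix Finset

/-! ### The binary tree of partial assignments -/

namespace ReadOnceTree

/-- The three kinds of vertices attached to a tree node `ν`: the node itself (`nd`), its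
absorber `m_ν` (`ab`) and its signed absorber `m'_ν` (`ab'`). [folklore] -/
inductive Kind
  | nd
  | ab
  | ab'
  deriving DecidableEq, Fintype

variable (k : ℕ)

/-- Tree nodes of the complete binary tree of depth `k`: a depth `d ≤ k` together with the bit
string of the `d` decisions taken so far, stored as a function `Fin k → Bool` that is `false`
from position `d` on (canonical representative). (A `def` with its own two instances: the
generic instances of the subtype are too large for the instance synthesiser once nested in
decidable predicates on the vertex type.) [folklore] -/
def Node : Type :=
  {p : Fin (k + 1) × (Fin k → Bool) // ∀ t : Fin k, (p.1 : ℕ) ≤ (t : ℕ) → p.2 t = false}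

/-- Finiteness of the node type (from the subtype). [folklore] -/
instance : Fintype (Node k) :=
  inferInstanceAs (Fintype {p : Fin (k + 1) × (Fin k → Bool) //
    ∀ t : Fin k, (p.1 : ℕ) ≤ (t : ℕ) → p.2 t = false})

/-- Decidable equality of nodes (from the subtype). [folklore] -/
instance : DecidableEq (Node k) :=
  inferInstanceAs (DecidableEq {p : Fin (k + 1) × (Fin k → Bool) //
    ∀ t : Fin k, (p.1 : ℕ) ≤ (t : ℕ) → p.2 t = false})

/-- The vertices of the gadget: for every tree node its three kinds, and the `k` variable
vertices `u_0, …, u_{k-1}` (`u_d` carries the loop `z_d` and serves the nodes of depth `d`). [folklore] -/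
abbrev V : Type := (Kind × Node k) ⊕ Fin k

variable {k}

namespace Node

/-- The depth of a node. [folklore] -/
def depth (ν : Node k) : ℕ := (ν.1.1 : ℕ)

/-- The bit string of a node (padded by `false`). [folklore] -/
def bits (ν : Node k) : Fin k → Bool := ν.1.2

/-- A node has depth at most `k`. [folklore] -/
theorem depth_le (ν : Node k) : ν.depth ≤ k := Nat.lt_succ_iff.1 ν.1.1.2

/-- The bit string of a node vanishes from its depth on (canonical representative). [folklore] -/
theorem bits_eq_false (ν : Node k) (t : Fin k) (h : ν.depth ≤ (t : ℕ)) : ν.bits t = false :=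
  ν.2 t h

/-- Extensionality for nodes: depth and bit string determine the node. [folklore] -/
theorem ext {ν ν' : Node k} (h₁ : ν.depth = ν'.depth) (h₂ : ν.bits = ν'.bits) : ν = ν' :=
  Subtype.ext (Prod.ext (Fin.ext h₁) h₂)

/-- Extensionality for nodes, as an `iff`. [folklore] -/
theorem ext_iff' {ν ν' : Node k} : ν = ν' ↔ ν.depth = ν'.depth ∧ ν.bits = ν'.bits :=
  ⟨fun h => by subst h; exact ⟨rfl, rfl⟩, fun h => ext h.1 h.2⟩

/-- The root: depth `0`. [folklore] -/
def root : Node k := ⟨(0, fun _ => false), fun _ _ => rfl⟩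

/-- The root has depth `0`. [folklore] -/
@[simp] theorem depth_root : (root : Node k).depth = 0 := rfl

/-- The root has the zero bit string. [folklore] -/
@[simp] theorem bits_root : (root : Node k).bits = fun _ => false := rfl

/-- The root is the only node of depth `0`. [folklore] -/
theorem eq_root_of_depth_eq_zero {ν : Node k} (h : ν.depth = 0) : ν = root :=
  ext h (funext fun t => ν.bits_eq_false t (by rw [h]; exact Nat.zero_le _))

/-- The child `ν b` of an internal node `ν` (depth `< k`): one level deeper, bit `b` recorded at
position `depth ν`. [folklore] -/
def child (ν : Node k) (b : Bool) (h : ν.depth < k) : Node k :=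
  ⟨(⟨ν.depth + 1, by have := ν.depth_le; omega⟩, Function.update ν.bits ⟨ν.depth, h⟩ b), by
    intro t ht
    change ν.depth + 1 ≤ (t : ℕ) at ht
    show Function.update ν.bits ⟨ν.depth, h⟩ b t = false
    have hne : t ≠ ⟨ν.depth, h⟩ := fun heq => by
      rw [heq] at ht; exact Nat.not_succ_le_self _ ht
    rw [Function.update_of_ne hne]
    exact ν.bits_eq_false t (by omega)⟩

/-- A child is one level deeper. [folklore] -/
@[simp] theorem depth_child (ν : Node k) (b : Bool) (h : ν.depth < k) :
    (ν.child b h).depth = ν.depth + 1 := rfl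

/-- The bit string of a child. [folklore] -/
theorem bits_child (ν : Node k) (b : Bool) (h : ν.depth < k) :
    (ν.child b h).bits = Function.update ν.bits ⟨ν.depth, h⟩ b := rfl

/-- The new bit of a child. [folklore] -/
theorem bits_child_self (ν : Node k) (b : Bool) (h : ν.depth < k) :
    (ν.child b h).bits ⟨ν.depth, h⟩ = b := by
  rw [bits_child, Function.update_self]

/-- A child keeps the earlier bits. [folklore] -/
theorem bits_child_of_lt (ν : Node k) (b : Bool) (h : ν.depth < k) (t : Fin k)
    (ht : (t : ℕ) < ν.depth) : (ν.child b h).bits t = ν.bits t := by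
  rw [bits_child, Function.update_of_ne]
  intro heq; rw [heq] at ht; exact lt_irrefl _ ht

/-- The two children of a node are distinct. [folklore] -/
theorem child_injective (ν : Node k) (h : ν.depth < k) {b b' : Bool}
    (hbb : ν.child b h = ν.child b' h) : b = b' := by
  have := congrArg (fun μ : Node k => μ.bits ⟨ν.depth, h⟩) hbb
  simpa [bits_child_self] using this

/-- A child is not the root. [folklore] -/
theorem child_ne_root (ν : Node k) (b : Bool) (h : ν.depth < k) : ν.child b h ≠ root := by
  intro heq
  have := congrArg depth heq
  simp at this

/-- A child is not its parent. [folklore] -/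
theorem child_ne_self (ν : Node k) (b : Bool) (h : ν.depth < k) : ν.child b h ≠ ν := by
  intro heq
  have := congrArg depth heq
  simp at this

/-- Two internal nodes with a common child are equal. [folklore] -/
theorem eq_of_child_eq {ν ν' : Node k} {b b' : Bool} (h : ν.depth < k) (h' : ν'.depth < k)
    (hc : ν.child b h = ν'.child b' h') : ν = ν' := by
  have hd : ν.depth = ν'.depth := by
    have := congrArg depth hc; simpa using this
  refine ext hd (funext fun t => ?_)
  by_cases ht : (t : ℕ) < ν.depth
  · have h1 : (ν.child b h).bits t = (ν'.child b' h').bits t := by rw [hc]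
    rwa [bits_child_of_lt _ _ _ _ ht, bits_child_of_lt _ _ _ _ (hd ▸ ht)] at h1
  · push Not at ht
    rw [ν.bits_eq_false t ht, ν'.bits_eq_false t (hd ▸ ht)]

end Node

/-- `some (ν b)` for an internal node, `none` for a leaf. [folklore] -/
def childOpt (ν : Node k) (b : Bool) : Option (Node k) :=
  if h : ν.depth < k then some (ν.child b h) else none

/-- `childOpt` returns exactly the children of internal nodes. [folklore] -/
theorem childOpt_eq_some_iff {ν ν' : Node k} {b : Bool} :
    childOpt ν b = some ν' ↔ ∃ h : ν.depth < k, ν' = ν.child b h := by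
  unfold childOpt
  split_ifs with h
  · simp only [Option.some.injEq]
    exact ⟨fun e => ⟨h, e.symm⟩, fun ⟨_, e⟩ => e.symm⟩
  · simp only [false_iff, not_exists]
    exact fun h' _ => h h'

/-- The depth of a vertex (`u_d` has depth `d`). [folklore] -/
def vdepth : V k → ℕ
  | Sum.inl (_, ν) => ν.depth
  | Sum.inr i => (i : ℕ)

/-- The depth of a node-type vertex. [folklore] -/
@[simp] theorem vdepth_inl (κ : Kind) (ν : Node k) : vdepth (Sum.inl (κ, ν) : V k) = ν.depth := rfl
/-- The depth of a variable vertex. [folklore] -/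
@[simp] theorem vdepth_inr (i : Fin k) : vdepth (Sum.inr i : V k) = (i : ℕ) := rfl

/-! ### The weights -/

section Weights

variable {R : Type*} [CommRing R] (y : (Fin k → Bool) → R) (z : Fin k → R)

/-- The weight `wt a b` of the edge `a → b` of the gadget (successor weights):
for a node `ν` of depth `d < k`: `ν → ν0`, `ν → m_ν`, `m_ν → ν1`, `m_ν ⇄ u_d`, `u_d → m'_ν`,
`m'_ν → u_d` of weight `1` and `m'_ν → ν1` of weight `-1`; loops of weight `1` on all non-root
nodes and on all `m_ν`, `m'_ν`; the loop `z_d` on `u_d`; and the edge `λ → root` of weight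
`y_λ` for every leaf `λ`. [cite: HrubesJoglekar2025, Thm. 3 (p. 53:4)] -/
def wt : V k → V k → R
  | Sum.inl (Kind.nd, ν), Sum.inl (Kind.nd, ν') =>
      if ν' = ν ∧ ν ≠ Node.root then 1
      else if childOpt ν false = some ν' then 1
      else if ν' = Node.root ∧ ν.depth = k then y ν.bits
      else 0
  | Sum.inl (Kind.nd, ν), Sum.inl (Kind.ab, ν') => if ν' = ν ∧ ν.depth < k then 1 else 0
  | Sum.inl (Kind.nd, _), Sum.inl (Kind.ab', _) => 0
  | Sum.inl (Kind.nd, _), Sum.inr _ => 0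
  | Sum.inl (Kind.ab, ν), Sum.inl (Kind.nd, ν') => if childOpt ν true = some ν' then 1 else 0
  | Sum.inl (Kind.ab, ν), Sum.inl (Kind.ab, ν') => if ν' = ν then 1 else 0
  | Sum.inl (Kind.ab, _), Sum.inl (Kind.ab', _) => 0
  | Sum.inl (Kind.ab, ν), Sum.inr i => if ν.depth = (i : ℕ) then 1 else 0
  | Sum.inl (Kind.ab', ν), Sum.inl (Kind.nd, ν') => if childOpt ν true = some ν' then -1 else 0
  | Sum.inl (Kind.ab', _), Sum.inl (Kind.ab, _) => 0
  | Sum.inl (Kind.ab', ν), Sum.inl (Kind.ab', ν') => if ν' = ν then 1 else 0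
  | Sum.inl (Kind.ab', ν), Sum.inr i => if ν.depth = (i : ℕ) then 1 else 0
  | Sum.inr _, Sum.inl (Kind.nd, _) => 0
  | Sum.inr i, Sum.inl (Kind.ab, ν) => if ν.depth = (i : ℕ) then 1 else 0
  | Sum.inr i, Sum.inl (Kind.ab', ν) => if ν.depth = (i : ℕ) then 1 else 0
  | Sum.inr i, Sum.inr i' => if i' = i then z i else 0

/-- The gadget matrix: entry `(r, c)` = weight of the edge `c → r`, so that
`per = ∑_σ ∏_c wt c (σ c)` sums over the successor maps `σ` (cycle covers).
[cite: HrubesJoglekar2025, Thm. 3 (p. 53:4)] -/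
def treeMatrix : Matrix (V k) (V k) R := fun r c => wt y z c r

/-- Entries of the gadget matrix. [folklore] -/
@[simp] theorem treeMatrix_apply (r c : V k) : treeMatrix y z r c = wt y z c r := rfl

/-! ### Entries: supports and values -/

section Entries

variable {y z}

open Kind Node

/-- Targets of a node `ν`: itself, the root, its child `ν0`, its absorber `m_ν`. [folklore] -/
theorem wt_nd_ne_zero {ν : Node k} {b : V k} (h : wt y z (Sum.inl (nd, ν)) b ≠ 0) :
    b = Sum.inl (nd, ν) ∨ b = Sum.inl (nd, root) ∨
      (∃ hν : ν.depth < k, b = Sum.inl (nd, ν.child false hν)) ∨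
      (b = Sum.inl (ab, ν) ∧ ν.depth < k) := by
  rcases b with ⟨κ', ν'⟩ | i' <;> (try rcases κ' with _ | _ | _) <;>
    simp only [wt, ne_eq] at h
  · split_ifs at h with h1 h2 h3
    · exact Or.inl (by rw [h1.1])
    · obtain ⟨hlt, rfl⟩ := childOpt_eq_some_iff.1 h2
      exact Or.inr (Or.inr (Or.inl ⟨hlt, rfl⟩))
    · exact Or.inr (Or.inl (by rw [h3.1]))
    · exact absurd rfl h
  · split_ifs at h with h1
    · exact Or.inr (Or.inr (Or.inr ⟨by rw [h1.1], h1.2⟩))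
    · exact absurd rfl h
  · exact absurd trivial h
  · exact absurd trivial h

/-- Targets of an absorber `m_ν`: itself, the child `ν1`, the variable vertex of its depth. [folklore] -/
theorem wt_ab_ne_zero {ν : Node k} {b : V k} (h : wt y z (Sum.inl (ab, ν)) b ≠ 0) :
    b = Sum.inl (ab, ν) ∨ (∃ hν : ν.depth < k, b = Sum.inl (nd, ν.child true hν)) ∨
      (∃ i : Fin k, b = Sum.inr i ∧ ν.depth = (i : ℕ)) := by
  rcases b with ⟨κ', ν'⟩ | i' <;> (try rcases κ' with _ | _ | _) <;>
    simp only [wt, ne_eq] at h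
  · split_ifs at h with h1
    · obtain ⟨hlt, rfl⟩ := childOpt_eq_some_iff.1 h1
      exact Or.inr (Or.inl ⟨hlt, rfl⟩)
    · exact absurd rfl h
  · split_ifs at h with h1
    · exact Or.inl (by rw [h1])
    · exact absurd rfl h
  · exact absurd trivial h
  · split_ifs at h with h1
    · exact Or.inr (Or.inr ⟨i', rfl, h1⟩)
    · exact absurd rfl h

/-- Targets of a signed absorber `m'_ν`: itself, the child `ν1`, the variable vertex of its depth. [folklore] -/
theorem wt_ab'_ne_zero {ν : Node k} {b : V k} (h : wt y z (Sum.inl (ab', ν)) b ≠ 0) :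
    b = Sum.inl (ab', ν) ∨ (∃ hν : ν.depth < k, b = Sum.inl (nd, ν.child true hν)) ∨
      (∃ i : Fin k, b = Sum.inr i ∧ ν.depth = (i : ℕ)) := by
  rcases b with ⟨κ', ν'⟩ | i' <;> (try rcases κ' with _ | _ | _) <;>
    simp only [wt, ne_eq] at h
  · split_ifs at h with h1
    · obtain ⟨hlt, rfl⟩ := childOpt_eq_some_iff.1 h1
      exact Or.inr (Or.inl ⟨hlt, rfl⟩)
    · exact absurd rfl h
  · exact absurd trivial h
  · split_ifs at h with h1
    · exact Or.inl (by rw [h1])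
    · exact absurd rfl h
  · split_ifs at h with h1
    · exact Or.inr (Or.inr ⟨i', rfl, h1⟩)
    · exact absurd rfl h

/-- Targets of a variable vertex `u_i`: itself and the absorbers of depth `i`. [folklore] -/
theorem wt_u_ne_zero {i : Fin k} {b : V k} (h : wt y z (Sum.inr i) b ≠ 0) :
    b = Sum.inr i ∨ (∃ ν : Node k, ν.depth = (i : ℕ) ∧ (b = Sum.inl (ab, ν) ∨ b = Sum.inl (ab', ν))) := by
  rcases b with ⟨κ', ν'⟩ | i' <;> (try rcases κ' with _ | _ | _) <;>
    simp only [wt, ne_eq] at h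
  · exact absurd trivial h
  · split_ifs at h with h1
    · exact Or.inr ⟨ν', h1, Or.inl rfl⟩
    · exact absurd rfl h
  · split_ifs at h with h1
    · exact Or.inr ⟨ν', h1, Or.inr rfl⟩
    · exact absurd rfl h
  · split_ifs at h with h1
    · exact Or.inl (by rw [h1])
    · exact absurd rfl h

/-- An edge `a → b` of non-zero weight either enters the root or does not decrease the depth. [folklore] -/
theorem depth_le_of_wt_ne_zero {a b : V k} (h : wt y z a b ≠ 0) :
    b = Sum.inl (nd, root) ∨ vdepth a ≤ vdepth b := by
  rcases a with ⟨κ, ν⟩ | i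
  · rcases κ with _ | _ | _
    · rcases wt_nd_ne_zero h with rfl | rfl | ⟨hν, rfl⟩ | ⟨rfl, -⟩
      · exact Or.inr le_rfl
      · exact Or.inl rfl
      · exact Or.inr (by simp)
      · exact Or.inr (by simp)
    · rcases wt_ab_ne_zero h with rfl | ⟨hν, rfl⟩ | ⟨i, rfl, hi⟩
      · exact Or.inr le_rfl
      · exact Or.inr (by simp)
      · exact Or.inr (by simp [hi])
    · rcases wt_ab'_ne_zero h with rfl | ⟨hν, rfl⟩ | ⟨i, rfl, hi⟩
      · exact Or.inr le_rfl
      · exact Or.inr (by simp)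
      · exact Or.inr (by simp [hi])
  · rcases wt_u_ne_zero h with rfl | ⟨ν, hν, rfl | rfl⟩
    · exact Or.inr le_rfl
    · exact Or.inr (by simp [hν])
    · exact Or.inr (by simp [hν])

/-- Contrapositive: a depth-decreasing edge not entering the root has weight `0`. [folklore] -/
theorem wt_eq_zero_of_lt {a b : V k} (hab : vdepth b < vdepth a)
    (hb : b ≠ Sum.inl (nd, root)) : wt y z a b = 0 := by
  by_contra h
  rcases depth_le_of_wt_ne_zero h with h' | h'
  · exact hb h'
  · exact absurd hab (not_lt.2 h')

/-! Values. -/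

/-- The loop at a non-root node has weight `1`. [folklore] -/
theorem wt_nd_self {ν : Node k} (hν : ν ≠ root) : wt y z (Sum.inl (nd, ν)) (Sum.inl (nd, ν)) = 1 := by
  simp [wt, hν]

/-- The edge `ν → ν0` has weight `1`. [folklore] -/
theorem wt_nd_child {ν : Node k} (hν : ν.depth < k) :
    wt y z (Sum.inl (nd, ν)) (Sum.inl (nd, ν.child false hν)) = 1 := by
  have h1 : ¬ (ν.child false hν = ν ∧ ν ≠ root) := fun h => ν.child_ne_self false hν h.1
  have h2 : childOpt ν false = some (ν.child false hν) := childOpt_eq_some_iff.2 ⟨hν, rfl⟩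
  simp [wt, h1, h2]

/-- The edge `ν → m_ν` has weight `1`. [folklore] -/
theorem wt_nd_ab_self {ν : Node k} (hν : ν.depth < k) :
    wt y z (Sum.inl (nd, ν)) (Sum.inl (ab, ν)) = 1 := by
  simp [wt, hν]

/-- The edge from a leaf to the root has weight `y_λ`. [folklore] -/
theorem wt_nd_root {ν : Node k} (hν : ν.depth = k) :
    wt y z (Sum.inl (nd, ν)) (Sum.inl (nd, root)) = y ν.bits := by
  have h1 : ¬ ((root : Node k) = ν ∧ ν ≠ root) := fun h => h.2 h.1.symm
  have h2 : childOpt ν false ≠ some root := fun h => by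
    obtain ⟨hlt, -⟩ := childOpt_eq_some_iff.1 h
    omega
  simp [wt, h1, h2, hν]

/-- The loop at `m_ν` has weight `1`. [folklore] -/
theorem wt_ab_self (ν : Node k) : wt y z (Sum.inl (ab, ν)) (Sum.inl (ab, ν)) = 1 := by
  simp [wt]

/-- The loop at `m'_ν` has weight `1`. [folklore] -/
theorem wt_ab'_self (ν : Node k) : wt y z (Sum.inl (ab', ν)) (Sum.inl (ab', ν)) = 1 := by
  simp [wt]

/-- The edge `m_ν → ν1` has weight `1`. [folklore] -/
theorem wt_ab_child {ν : Node k} (hν : ν.depth < k) :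
    wt y z (Sum.inl (ab, ν)) (Sum.inl (nd, ν.child true hν)) = 1 := by
  have h2 : childOpt ν true = some (ν.child true hν) := childOpt_eq_some_iff.2 ⟨hν, rfl⟩
  simp [wt, h2]

/-- The edge `m'_ν → ν1` has weight `-1` (the sign that makes wrong returns cancel). [folklore] -/
theorem wt_ab'_child {ν : Node k} (hν : ν.depth < k) :
    wt y z (Sum.inl (ab', ν)) (Sum.inl (nd, ν.child true hν)) = -1 := by
  have h2 : childOpt ν true = some (ν.child true hν) := childOpt_eq_some_iff.2 ⟨hν, rfl⟩
  simp [wt, h2]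

/-- The edge `m_ν → u_d` has weight `1`. [folklore] -/
theorem wt_ab_u {ν : Node k} {i : Fin k} (h : ν.depth = (i : ℕ)) :
    wt y z (Sum.inl (ab, ν)) (Sum.inr i) = 1 := by
  simp [wt, h]

/-- The edge `m'_ν → u_d` has weight `1`. [folklore] -/
theorem wt_ab'_u {ν : Node k} {i : Fin k} (h : ν.depth = (i : ℕ)) :
    wt y z (Sum.inl (ab', ν)) (Sum.inr i) = 1 := by
  simp [wt, h]

/-- The edge `u_d → m_ν` has weight `1`. [folklore] -/
theorem wt_u_ab {ν : Node k} {i : Fin k} (h : ν.depth = (i : ℕ)) :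
    wt y z (Sum.inr i) (Sum.inl (ab, ν)) = 1 := by
  simp [wt, h]

/-- The edge `u_d → m'_ν` has weight `1`. [folklore] -/
theorem wt_u_ab' {ν : Node k} {i : Fin k} (h : ν.depth = (i : ℕ)) :
    wt y z (Sum.inr i) (Sum.inl (ab', ν)) = 1 := by
  simp [wt, h]

/-- The loop at `u_i` has weight `z_i`. [folklore] -/
theorem wt_u_self (i : Fin k) : wt y z (Sum.inr i) (Sum.inr i) = z i := by
  simp [wt]

/-- There is no edge from a variable vertex to a node. [folklore] -/
theorem wt_u_nd (i : Fin k) (ν : Node k) : wt y z (Sum.inr i) (Sum.inl (nd, ν)) = 0 := rfl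

/-- There is no edge between distinct variable vertices. [folklore] -/
theorem wt_u_u_of_ne {i i' : Fin k} (h : i' ≠ i) : wt y z (Sum.inr i) (Sum.inr i') = 0 := by
  simp [wt, h]

end Entries

/-! ### Idle blocks of one depth -/

section Idle

variable {y z}

open Kind Node

/-- Rank function for the ranked-diagonal evaluation: nodes below absorbers below variable
vertices. [folklore] -/
def rk : V k → ℕ
  | Sum.inl (Kind.nd, _) => 0
  | Sum.inl (Kind.ab, _) => 1
  | Sum.inl (Kind.ab', _) => 1
  | Sum.inr _ => 2

/-- `true` on the absorbers `m_ν`, `m'_ν`. [folklore] -/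
def isAbs : V k → Bool
  | Sum.inl (Kind.ab, _) => true
  | Sum.inl (Kind.ab', _) => true
  | _ => false

/-- **An idle block without its variable vertex is the identity**: a block of vertices of one
depth `d`, not containing the root nor any variable vertex, has block subpermanent `1` (its only
internal edges are loops of weight `1` and the rank-increasing edges `ν → m_ν`). [folklore] -/
theorem subperm_level_eq_one (d : ℕ) (P Q : V k → Prop) [DecidablePred P] [DecidablePred Q]
    (hPQ : ∀ v, P v ↔ Q v)
    (hP : ∀ v, P v → vdepth v = d) (hPu : ∀ i, ¬ P (Sum.inr i))
    (hroot : ¬ P (Sum.inl (nd, root))) :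
    (treeMatrix y z).subperm P Q = 1 := by
  rw [(treeMatrix y z).subperm_congr (p := P) (q := Q) (p' := P) (q' := P) (fun _ => Iff.rfl)
    (fun v => (hPQ v).symm)]
  refine (treeMatrix y z).subperm_self_eq_one_of_rank rk (fun i j hi hj hij => ?_) (fun i hi => ?_)
  · rw [treeMatrix_apply] at hij
    rcases i with ⟨κ, ν⟩ | i
    · rcases κ with _ | _ | _
      · rcases wt_nd_ne_zero hij with rfl | rfl | ⟨hν, rfl⟩ | ⟨rfl, -⟩
        · exact Or.inl rfl
        · exact absurd hj hroot
        · have h1 := hP _ hi; have h2 := hP _ hj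
          simp at h1 h2; omega
        · exact Or.inr (by simp [rk])
      · rcases wt_ab_ne_zero hij with rfl | ⟨hν, rfl⟩ | ⟨i, rfl, -⟩
        · exact Or.inl rfl
        · have h1 := hP _ hi; have h2 := hP _ hj
          simp at h1 h2; omega
        · exact absurd hj (hPu i)
      · rcases wt_ab'_ne_zero hij with rfl | ⟨hν, rfl⟩ | ⟨i, rfl, -⟩
        · exact Or.inl rfl
        · have h1 := hP _ hi; have h2 := hP _ hj
          simp at h1 h2; omega
        · exact absurd hj (hPu i)
    · exact absurd hi (hPu i)
  · rw [treeMatrix_apply]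
    rcases i with ⟨κ, ν⟩ | i
    · rcases κ with _ | _ | _
      · exact wt_nd_self (fun h => hroot (h ▸ hi))
      · exact wt_ab_self ν
      · exact wt_ab'_self ν
    · exact absurd hi (hPu i)

/-- One absorber `a` of depth `d` in `2`-cycle with `u_d`: the term of `a` in the expansion of an
idle block along the column `u_d` is `1` (the entries `u_d → a`, `a → u_d` are `1`, the rest of
the block takes its loops). [folklore] -/
theorem absorber_term (d : ℕ) (hd : d < k) (P : V k → Prop) [DecidablePred P]
    (hP : ∀ v, P v → vdepth v = d) (hPu : P (Sum.inr ⟨d, hd⟩))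
    (hroot : ¬ P (Sum.inl (nd, root))) (a : V k) (hPa : P a) (habs : isAbs a = true) :
    treeMatrix y z a (Sum.inr ⟨d, hd⟩) * (treeMatrix y z).subperm
      (fun i => P i ∧ i ≠ Sum.inr ⟨d, hd⟩) (fun j => P j ∧ j ≠ a) = 1 := by
  have hPu' : ∀ i, P (Sum.inr i) → i = ⟨d, hd⟩ := fun i hi => Fin.ext (by simpa using hP _ hi)
  -- `a = m_ν` or `a = m'_ν` with `ν` of depth `d`
  obtain ⟨κ, ν, hκ, rfl⟩ : ∃ κ ν, (κ = ab ∨ κ = ab') ∧ a = Sum.inl (κ, ν) := by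
    rcases a with ⟨κ, ν⟩ | i
    · rcases κ with _ | _ | _
      · simp [isAbs] at habs
      · exact ⟨ab, ν, Or.inl rfl, rfl⟩
      · exact ⟨ab', ν, Or.inr rfl, rfl⟩
    · simp [isAbs] at habs
  have hνd : ν.depth = d := by simpa using hP _ hPa
  have hau : (Sum.inl (κ, ν) : V k) ≠ Sum.inr ⟨d, hd⟩ := by simp
  -- the entry `u_d → a`
  have h1 : treeMatrix y z (Sum.inl (κ, ν)) (Sum.inr ⟨d, hd⟩) = 1 := by
    rw [treeMatrix_apply]
    rcases hκ with rfl | rfl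
    · exact wt_u_ab hνd
    · exact wt_u_ab' hνd
  -- the entry `a → u_d`
  have h2 : treeMatrix y z (Sum.inr ⟨d, hd⟩) (Sum.inl (κ, ν)) = 1 := by
    rw [treeMatrix_apply]
    rcases hκ with rfl | rfl
    · exact wt_ab_u hνd
    · exact wt_ab'_u hνd
  rw [h1, one_mul, (treeMatrix y z).subperm_col_one (Sum.inl (κ, ν)) (Sum.inr ⟨d, hd⟩)
    ⟨hPa, hau⟩ ⟨hPu, hau.symm⟩ (fun r' hr' hne => ?_), h2, one_mul]
  · exact subperm_level_eq_one d _ _ (fun v => by tauto) (fun v hv => hP v hv.1.1)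
      (fun i hi => hi.1.2 (by rw [hPu' i hi.1.1])) (fun h => hroot h.1.1)
  · -- no other successor of `a` inside the block
    rw [treeMatrix_apply]
    by_contra hw
    rcases hκ with rfl | rfl
    · rcases wt_ab_ne_zero hw with h | ⟨hν, h⟩ | ⟨i, h, hi⟩
      · exact hr'.2 h
      · have := hP _ hr'.1; rw [h] at this; simp at this; omega
      · rw [h] at hne hr'; exact hne (by rw [hPu' i hr'.1])
    · rcases wt_ab'_ne_zero hw with h | ⟨hν, h⟩ | ⟨i, h, hi⟩
      · exact hr'.2 h
      · have := hP _ hr'.1; rw [h] at this; simp at this; omega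
      · rw [h] at hne hr'; exact hne (by rw [hPu' i hr'.1])

/-- The number `K_d` of absorbers of depth `d` (twice the number of nodes of depth `d`). [folklore] -/
def levelConst (k d : ℕ) : ℕ := (univ.filter fun v : V k => vdepth v = d ∧ isAbs v = true).card

/-- **An idle block with its variable vertex**: a block of vertices of one depth `d < k`
containing `u_d` but not the root has block subpermanent `z_d + (number of absorbers in the
block)`: either `u_d` takes its loop, or it forms a `2`-cycle with one absorber (weight `1 · 1`),
everything else taking loops. [folklore] -/
theorem subperm_level_eq (d : ℕ) (hd : d < k) (P : V k → Prop) [DecidablePred P]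
    (hP : ∀ v, P v → vdepth v = d) (hPu : P (Sum.inr ⟨d, hd⟩))
    (hroot : ¬ P (Sum.inl (nd, root))) :
    (treeMatrix y z).subperm P P =
      z ⟨d, hd⟩ + ((univ.filter fun v => P v ∧ isAbs v = true).card : R) := by
  have hPu' : ∀ i, P (Sum.inr i) → i = ⟨d, hd⟩ := fun i hi => Fin.ext (by simpa using hP _ hi)
  rw [(treeMatrix y z).subperm_expand_col (Sum.inr ⟨d, hd⟩) hPu, ← Finset.add_sum_erase _ _
    (Finset.mem_filter.2 ⟨Finset.mem_univ _, hPu⟩)]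
  have eloop : treeMatrix y z (Sum.inr ⟨d, hd⟩) (Sum.inr ⟨d, hd⟩) *
      (treeMatrix y z).subperm (fun i => P i ∧ i ≠ Sum.inr ⟨d, hd⟩)
        (fun j => P j ∧ j ≠ Sum.inr ⟨d, hd⟩) = z ⟨d, hd⟩ := by
    -- the loop at `u_d`
    rw [treeMatrix_apply, wt_u_self, subperm_level_eq_one d _ _ (fun _ => Iff.rfl)
      (fun v hv => hP v hv.1) (fun i hi => hi.2 (by rw [hPu' i hi.1])) (fun h => hroot h.1), mul_one]
  rw [eloop, add_right_inj]
  · -- one term `1` per absorber of the block, `0` for the nodes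
    rw [Finset.card_eq_sum_ones, Nat.cast_sum, Nat.cast_one,
      ← Finset.sum_filter_add_sum_filter_not (((univ.filter P).erase (Sum.inr ⟨d, hd⟩)))
        (fun v => isAbs v = true)]
    rw [Finset.sum_eq_zero (s := ((univ.filter P).erase (Sum.inr ⟨d, hd⟩)).filter
      (fun v => ¬ isAbs v = true)), add_zero]
    · have hset : ((univ.filter P).erase (Sum.inr ⟨d, hd⟩)).filter (fun v => isAbs v = true) =
          univ.filter (fun v => P v ∧ isAbs v = true) := by
        ext v
        simp only [Finset.mem_filter, Finset.mem_erase, Finset.mem_univ, true_and]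
        constructor
        · rintro ⟨⟨-, hv⟩, ha⟩; exact ⟨hv, ha⟩
        · rintro ⟨hv, ha⟩; exact ⟨⟨fun h => by simp [h, isAbs] at ha, hv⟩, ha⟩
      rw [hset]
      refine Finset.sum_congr rfl fun a ha => ?_
      obtain ⟨hPa, habs⟩ := (Finset.mem_filter.1 ha).2
      exact absorber_term d hd P hP hPu hroot a hPa habs
    · intro v hv
      obtain ⟨hv1, hv2⟩ := Finset.mem_filter.1 hv
      obtain ⟨hvu, hPv⟩ := Finset.mem_erase.1 hv1
      have hPv : P v := (Finset.mem_filter.1 hPv).2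
      rcases v with ⟨κ, ν⟩ | i
      · rcases κ with _ | _ | _
        · rw [treeMatrix_apply, wt_u_nd, zero_mul]
        · simp [isAbs] at hv2
        · simp [isAbs] at hv2
      · exact absurd (by rw [hPu' i hPv]) hvu

/-- The idle-block constant of a level: `levelConst`. [folklore] -/
theorem subperm_level_eq' (d : ℕ) (hd : d < k) (P : V k → Prop) [DecidablePred P]
    (hP : ∀ v, P v → vdepth v = d) (hPu : P (Sum.inr ⟨d, hd⟩))
    (hroot : ¬ P (Sum.inl (nd, root))) (E : Finset (V k))
    (hPE : ∀ v, isAbs v = true → vdepth v = d → (P v ↔ v ∉ E))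
    (hE : ∀ v ∈ E, isAbs v = true ∧ vdepth v = d) :
    (treeMatrix y z).subperm P P = z ⟨d, hd⟩ + (levelConst k d : R) - (E.card : R) := by
  rw [subperm_level_eq d hd P hP hPu hroot]
  have hsub : E ⊆ univ.filter (fun v : V k => vdepth v = d ∧ isAbs v = true) := fun v hv =>
    Finset.mem_filter.2 ⟨Finset.mem_univ _, (hE v hv).2, (hE v hv).1⟩
  have : univ.filter (fun v => P v ∧ isAbs v = true) =
      univ.filter (fun v : V k => vdepth v = d ∧ isAbs v = true) \ E := by
    ext v
    simp only [Finset.mem_filter, Finset.mem_univ, true_and, Finset.mem_sdiff]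
    constructor
    · rintro ⟨hv, ha⟩; exact ⟨⟨hP v hv, ha⟩, (hPE v ha (hP v hv)).1 hv⟩
    · rintro ⟨⟨hv, ha⟩, hvE⟩; exact ⟨(hPE v ha hv).2 hvE, ha⟩
  rw [this, Finset.card_sdiff_of_subset hsub, Nat.cast_sub (Finset.card_le_card hsub)]
  unfold levelConst
  ring

end Idle

/-! ### Path sums below a node and the splitting step -/

section Path

variable {y z}

open Kind Node

/-- Every vertex has depth at most `k`. [folklore] -/
theorem vdepth_le (v : V k) : vdepth v ≤ k := by
  rcases v with ⟨κ, ν⟩ | i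
  · exact ν.depth_le
  · exact i.2.le

/-- The loop entry at the root vanishes when `k ≥ 1`. [folklore] -/
theorem wt_nd_nd_root_eq_zero {μ : Node k} (hμ : μ.depth < k) :
    wt y z (Sum.inl (nd, μ)) (Sum.inl (nd, root)) = 0 := by
  have h1 : ¬ ((root : Node k) = μ ∧ μ ≠ root) := fun h => h.2 h.1.symm
  have h2 : childOpt μ false ≠ some root := fun h => by
    obtain ⟨hlt, h⟩ := childOpt_eq_some_iff.1 h
    exact μ.child_ne_root false hlt h.symm
  have h3 : μ.depth ≠ k := hμ.ne
  simp [wt, h1, h2, h3]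

/-- The columns of depth `≥ d`. [folklore] -/
def Low (d : ℕ) : V k → Prop := fun v => d ≤ vdepth v

/-- `Low d` is decidable. [folklore] -/
instance (d : ℕ) : DecidablePred (Low (k := k) d) := fun v =>
  inferInstanceAs (Decidable (d ≤ vdepth v))

/-- Unfolding `Low`. [folklore] -/
theorem low_iff {d : ℕ} {v : V k} : Low d v ↔ d ≤ vdepth v := Iff.rfl

/-- The rows of depth `≥ d` other than `c`, together with the root. [folklore] -/
def RowQ (d : ℕ) (c : V k) : V k → Prop := fun r =>
  (d ≤ vdepth r ∧ r ≠ c) ∨ r = Sum.inl (nd, root)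

/-- `RowQ d c` is decidable. [folklore] -/
instance (d : ℕ) (c : V k) : DecidablePred (RowQ d c) := fun r =>
  inferInstanceAs (Decidable ((d ≤ vdepth r ∧ r ≠ c) ∨ r = Sum.inl (nd, root)))

/-- Unfolding `RowQ`. [folklore] -/
theorem rowQ_iff {d : ℕ} {c r : V k} :
    RowQ d c r ↔ (d ≤ vdepth r ∧ r ≠ c) ∨ r = Sum.inl (nd, root) := Iff.rfl

/-- The **path sum below the node `μ`** of depth `d`: the subpermanent on the columns of depth
`≥ d` and the rows of depth `≥ d` other than `μ` together with the root — the total weight of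
the ways to continue the main cycle from `μ` down to a leaf and back to the root, covering all
deeper vertices. [folklore] -/
def pathSub (y : (Fin k → Bool) → R) (z : Fin k → R) (μ : Node k) : R :=
  (treeMatrix y z).subperm (Low μ.depth) (RowQ μ.depth (Sum.inl (nd, μ)))

/-- **Splitting off the deeper levels** (forced Laplace expansion, `Matrix.subperm_laplace_exact`):
once the main cycle has entered the node `ν'` of depth `d + 1`, the columns of depth `≥ d + 1`
are supported in the rows of depth `≥ d + 1` and the root, so the subpermanent factors as the
path sum below `ν'` times the idle block of depth `d`. The predicates are described by
hypotheses to keep the lemma reusable. [folklore] -/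
theorem subperm_split {d : ℕ} (ν' : Node k) (hν' : ν'.depth = d + 1)
    (p q p₂ q₂ : V k → Prop) [DecidablePred p] [DecidablePred q] [DecidablePred p₂]
    [DecidablePred q₂]
    (hp_deep : ∀ v, d + 1 ≤ vdepth v → p v) (hp_le : ∀ v, p v → d ≤ vdepth v)
    (hq_deep : ∀ r, d + 1 ≤ vdepth r → r ≠ Sum.inl (nd, ν') → q r)
    (hq_root : q (Sum.inl (nd, root))) (hq_not : ¬ q (Sum.inl (nd, ν')))
    (hq_le : ∀ r, q r → r ≠ Sum.inl (nd, root) → d ≤ vdepth r)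
    (hp₂ : ∀ v, p₂ v ↔ p v ∧ vdepth v = d)
    (hq₂ : ∀ r, q₂ r ↔ q r ∧ vdepth r = d ∧ r ≠ Sum.inl (nd, root)) :
    (treeMatrix y z).subperm p q = pathSub y z ν' * (treeMatrix y z).subperm p₂ q₂ := by
  set B : Finset (V k) := univ.filter fun r =>
    (d + 1 ≤ vdepth r ∧ r ≠ Sum.inl (nd, ν')) ∨ r = Sum.inl (nd, root) with hB
  set F : Finset (V k) := univ.filter fun v => d + 1 ≤ vdepth v with hF
  have hmemB : ∀ r, r ∈ B ↔ (d + 1 ≤ vdepth r ∧ r ≠ Sum.inl (nd, ν')) ∨ r = Sum.inl (nd, root) :=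
    fun r => by simp [hB]
  have hmemF : ∀ v, v ∈ F ↔ d + 1 ≤ vdepth v := fun v => by simp [hF]
  have hroot_ne : (Sum.inl (nd, root) : V k) ≠ Sum.inl (nd, ν') := fun h => by
    have := congrArg vdepth h; simp at this; omega
  -- the two factors
  have e1 : (treeMatrix y z).subperm (· ∈ F) (· ∈ B) = pathSub y z ν' := by
    unfold pathSub
    exact (treeMatrix y z).subperm_congr (fun v => by rw [hmemF, low_iff, hν'])
      (fun r => by rw [hmemB, rowQ_iff, hν'])
  have e2 : (treeMatrix y z).subperm (fun i => p i ∧ i ∉ F) (fun j => q j ∧ j ∉ B) =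
      (treeMatrix y z).subperm p₂ q₂ := by
    refine (treeMatrix y z).subperm_congr (fun v => ?_) (fun r => ?_)
    · rw [hp₂, hmemF]; constructor
      · rintro ⟨hpv, hv⟩; exact ⟨hpv, by have := hp_le v hpv; omega⟩
      · rintro ⟨hpv, hv⟩; exact ⟨hpv, by omega⟩
    · rw [hq₂, hmemB]; constructor
      · rintro ⟨hqr, hr⟩
        have hr1 : r ≠ Sum.inl (nd, root) := fun h => hr (Or.inr h)
        have hr2 : r ≠ Sum.inl (nd, ν') := fun h => hq_not (h ▸ hqr)
        refine ⟨hqr, ?_, hr1⟩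
        have := hq_le r hqr hr1
        by_contra hne
        exact hr (Or.inl ⟨by omega, hr2⟩)
      · rintro ⟨hqr, hr, hr1⟩
        exact ⟨hqr, fun h => h.elim (fun h => by omega) hr1⟩
  -- the hypotheses of the exact Laplace splitting
  have hB' : ∀ j ∈ B, q j := fun j hj => by
    rcases (hmemB j).1 hj with ⟨hj1, hj2⟩ | rfl
    · exact hq_deep j hj1 hj2
    · exact hq_root
  have hFp : ∀ i ∈ F, p i := fun i hi => hp_deep i ((hmemF i).1 hi)
  have hF' : ∀ i ∈ F, ∀ j, q j → j ∉ B → treeMatrix y z j i = 0 := by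
    intro i hi j hj hjB
    rw [treeMatrix_apply]
    have hj1 : j ≠ Sum.inl (nd, root) := fun h => hjB ((hmemB j).2 (Or.inr h))
    refine wt_eq_zero_of_lt ?_ hj1
    have hi' := (hmemF i).1 hi
    have : ¬ (d + 1 ≤ vdepth j) := fun h =>
      hjB ((hmemB j).2 (Or.inl ⟨h, fun h' => hq_not (h' ▸ hj)⟩))
    omega
  have hcard : F.card = B.card := by
    have hν'F : (Sum.inl (nd, ν') : V k) ∈ F := (hmemF _).2 (by simp [hν'])
    have hrootF : (Sum.inl (nd, root) : V k) ∉ F.erase (Sum.inl (nd, ν')) := fun h => by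
      have := (hmemF _).1 (Finset.mem_erase.1 h).2; simp at this
    have hBeq : B = insert (Sum.inl (nd, root)) (F.erase (Sum.inl (nd, ν'))) := by
      ext r
      rw [hmemB, Finset.mem_insert, Finset.mem_erase, hmemF]
      constructor
      · rintro (⟨h1, h2⟩ | h)
        · exact Or.inr ⟨h2, h1⟩
        · exact Or.inl h
      · rintro (h | ⟨h2, h1⟩)
        · exact Or.inr h
        · exact Or.inl ⟨h1, h2⟩
    rw [hBeq, Finset.card_insert_of_notMem hrootF, Finset.card_erase_of_mem hν'F]
    have := Finset.card_pos.2 ⟨_, hν'F⟩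
    omega
  rw [(treeMatrix y z).subperm_laplace_exact B hB' F hFp hF' hcard, e1, e2]

/-- **A leaf**: the path sum below a leaf `λ` is `y_λ` (the edge `λ → root`, all other vertices of
depth `k` taking their loops). [folklore] -/
theorem pathSub_leaf (μ : Node k) (hμ : μ.depth = k) : pathSub y z μ = y μ.bits := by
  have hroot_of : ∀ r : V k, k ≤ vdepth r → r = Sum.inl (nd, root) → μ = root := by
    intro r hr h
    rw [h] at hr
    simp only [vdepth_inl, depth_root, nonpos_iff_eq_zero] at hr
    exact eq_root_of_depth_eq_zero (by omega)
  -- no other successor of the leaf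
  have hz : ∀ r', RowQ k (Sum.inl (nd, μ)) r' → r' ≠ Sum.inl (nd, root) →
      treeMatrix y z r' (Sum.inl (nd, μ)) = 0 := by
    intro r' hr' hne
    rw [treeMatrix_apply]
    by_contra hw
    rcases wt_nd_ne_zero hw with h | h | ⟨hν, -⟩ | ⟨-, hν⟩
    · rw [h] at hr'
      rcases hr' with ⟨-, h'⟩ | h'
      · exact h' rfl
      · exact hne (h.trans h')
    · exact hne h
    · omega
    · omega
  -- the rest of depth `k` takes its loops
  have hidle : (treeMatrix y z).subperm (fun i => Low k i ∧ i ≠ Sum.inl (nd, μ))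
      (fun j => RowQ k (Sum.inl (nd, μ)) j ∧ j ≠ Sum.inl (nd, root)) = 1 :=
    subperm_level_eq_one k _ _
      (fun v => ⟨fun ⟨hv1, hv2⟩ => ⟨Or.inl ⟨hv1, hv2⟩, fun h => hv2 (by rw [h, hroot_of v hv1 h])⟩,
        fun ⟨h, hne'⟩ => h.elim id (fun h => absurd h hne')⟩)
      (fun v hv => le_antisymm (vdepth_le v) hv.1)
      (fun i hi => absurd (low_iff.1 hi.1) (by simp))
      (fun h => h.2 (by rw [hroot_of _ (low_iff.1 h.1) rfl]))
  unfold pathSub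
  rw [hμ, (treeMatrix y z).subperm_col_one (Sum.inl (nd, μ)) (Sum.inl (nd, root))
    (show Low k (Sum.inl (nd, μ)) by rw [low_iff]; simp [hμ])
    (show RowQ k _ _ from Or.inr rfl) hz, treeMatrix_apply, wt_nd_root hμ, hidle, mul_one]

/-- **The splitting recursion**: for an internal node `μ` of depth `d`,
`S(μ) = S(μ0) · (z_d + K_d) + S(μ1) · (z_d + K_d - 2)`, where `K_d` is the number of absorbers
of depth `d`. The main cycle leaves `μ` either to `μ0` (then `u_d` takes its loop `z_d` or pairs
with any of the `K_d` absorbers) or to `m_μ`; from `m_μ` either to `μ1` (then `u_d` has `K_d - 1`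
absorbers left) or to `u_d`, which continues to an absorber `m_ν`, `ν ≠ μ` (weight `+S(ν1)`) or
`m'_ν` (weight `-S(ν1)`): these cancel except for `-S(μ1)`. [cite: HrubesJoglekar2025, Thm. 3 (p. 53:4)] -/
theorem pathSub_step (μ : Node k) {d : ℕ} (hμ : μ.depth = d) (hd : d < k) :
    pathSub y z μ =
      pathSub y z (μ.child false (hμ ▸ hd)) * (z ⟨d, hd⟩ + (levelConst k d : R)) +
        pathSub y z (μ.child true (hμ ▸ hd)) * (z ⟨d, hd⟩ + (levelConst k d : R) - 2) := by
  have hμk : μ.depth < k := hμ ▸ hd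
  -- names (only ever rewritten inside stand-alone `have`s)
  set c : V k := Sum.inl (nd, μ) with hc
  set m : V k := Sum.inl (ab, μ) with hm
  set u : V k := Sum.inr ⟨d, hd⟩ with hu
  set μ0 := μ.child false hμk with hμ0
  set μ1 := μ.child true hμk with hμ1
  set Dn : Finset (V k) := univ.filter fun v : V k => vdepth v = d ∧ isAbs v = true with hDn
  have hmemDn : ∀ v, v ∈ Dn ↔ vdepth v = d ∧ isAbs v = true := fun v => by simp [hDn]
  have hmDn : m ∈ Dn := (hmemDn m).2 ⟨by simp [hm, hμ], by simp [hm, isAbs]⟩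
  -- depths and distinctness
  have hdc : vdepth c = d := by simp [hc, hμ]
  have hdm : vdepth m = d := by simp [hm, hμ]
  have hdu : vdepth u = d := by simp [hu]
  have hd0 : vdepth (Sum.inl (nd, μ0) : V k) = d + 1 := by simp [hμ0, hμ]
  have hd1 : vdepth (Sum.inl (nd, μ1) : V k) = d + 1 := by simp [hμ1, hμ]
  have hmc : m ≠ c := by simp [hm, hc]
  have huc : u ≠ c := by simp [hu, hc]
  have hum : u ≠ m := by simp [hu, hm]
  have h0c : (Sum.inl (nd, μ0) : V k) ≠ c := fun h => by rw [h] at hd0; omega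
  have h0m : (Sum.inl (nd, μ0) : V k) ≠ m := by simp [hm]
  have h1m : (Sum.inl (nd, μ1) : V k) ≠ m := by simp [hm]
  have h1u : (Sum.inl (nd, μ1) : V k) ≠ u := by simp [hu]
  have hroot_m : (Sum.inl (nd, root) : V k) ≠ m := by simp [hm]
  have hroot_u : (Sum.inl (nd, root) : V k) ≠ u := by simp [hu]
  have hc_abs : isAbs c = false := by simp [hc, isAbs]
  have hu_abs : isAbs u = false := by simp [hu, isAbs]
  have hm_abs : isAbs m = true := by simp [hm, isAbs]
  have hroot_c : ∀ r : V k, vdepth r = d → r ≠ c → r ≠ Sum.inl (nd, root) := by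
    intro r hr hrc h
    rw [h] at hr hrc
    simp only [vdepth_inl, depth_root] at hr
    exact hrc (by rw [hc, eq_root_of_depth_eq_zero (hμ.trans hr.symm)])
  have hne_of_abs : ∀ v : V k, isAbs v = true → v ≠ c ∧ v ≠ u := fun v hv =>
    ⟨fun h => by rw [h, hc_abs] at hv; exact Bool.noConfusion hv,
      fun h => by rw [h, hu_abs] at hv; exact Bool.noConfusion hv⟩
  -- the row predicate `RowQ d c`
  have hqroot : RowQ d c (Sum.inl (nd, root)) := Or.inr rfl
  have hq_of_deep : ∀ r : V k, d + 1 ≤ vdepth r → RowQ d c r := fun r hr =>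
    Or.inl ⟨by omega, fun h => by rw [h, hdc] at hr; omega⟩
  have hq_le : ∀ r, RowQ d c r → r ≠ Sum.inl (nd, root) → d ≤ vdepth r := fun r hr hne =>
    (hr.resolve_right hne).1
  have hq_c : ∀ r, RowQ d c r → r ≠ Sum.inl (nd, root) → r ≠ c := fun r hr hne =>
    (hr.resolve_right hne).2
  -- entries used
  have e_c0 : treeMatrix y z (Sum.inl (nd, μ0)) c = 1 := by
    rw [treeMatrix_apply, hc, hμ0]; exact wt_nd_child hμk
  have e_cm : treeMatrix y z m c = 1 := by
    rw [treeMatrix_apply, hc, hm]; exact wt_nd_ab_self hμk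
  have e_m1 : treeMatrix y z (Sum.inl (nd, μ1)) m = 1 := by
    rw [treeMatrix_apply, hm, hμ1]; exact wt_ab_child hμk
  have e_mu : treeMatrix y z u m = 1 := by
    rw [treeMatrix_apply, hm, hu]; exact wt_ab_u hμ
  -- vanishing entries: other successors of `c`, `m_μ`, `u_d` do not occur
  have hz_c : ∀ r, RowQ d c r → r ≠ Sum.inl (nd, μ0) → r ≠ m → treeMatrix y z r c = 0 := by
    intro r hr h1 h2
    rw [treeMatrix_apply]
    by_contra hw
    have hw' := hw
    rw [hc] at hw'
    rcases wt_nd_ne_zero hw' with h | h | ⟨hν, h⟩ | ⟨h, -⟩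
    · -- the loop: `RowQ d c c` forces `μ = root`, where the loop entry vanishes (`d < k`)
      have hrc : r = c := h.trans hc.symm
      rcases hr with ⟨-, h'⟩ | h'
      · exact h' hrc
      · have hμr : μ = root := by
          have := hrc.symm.trans h'; rw [hc] at this; simpa using this
        rw [h, hμr] at hw'
        exact hw' (wt_nd_nd_root_eq_zero (by rw [← hμr]; exact hμk))
    · rw [h] at hw'; exact hw' (wt_nd_nd_root_eq_zero hμk)
    · exact h1 (by rw [h, hμ0])
    · exact h2 (by rw [h, hm])
  have hz_m : ∀ r, (RowQ d c r ∧ r ≠ m) → r ≠ Sum.inl (nd, μ1) → r ≠ u →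
      treeMatrix y z r m = 0 := by
    intro r hr h1 h2
    rw [treeMatrix_apply]
    by_contra hw
    have hw' := hw
    rw [hm] at hw'
    rcases wt_ab_ne_zero hw' with h | ⟨hν, h⟩ | ⟨i, h, hi⟩
    · exact hr.2 (h.trans hm.symm)
    · exact h1 (by rw [h, hμ1])
    · apply h2; rw [h, hu]; congr; exact Fin.ext (hμ.symm.trans hi).symm
  have hz_u : ∀ j, ((RowQ d c j ∧ j ≠ m) ∧ j ≠ u) → j ∉ Dn → treeMatrix y z j u = 0 := by
    intro j hj hjD
    rw [treeMatrix_apply]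
    by_contra hw
    have hw' := hw
    rw [hu] at hw'
    rcases wt_u_ne_zero hw' with h | ⟨ν, hν, h | h⟩
    · exact hj.2 (h.trans hu.symm)
    · exact hjD ((hmemDn j).2 ⟨by simp [h, hν], by simp [h, isAbs]⟩)
    · exact hjD ((hmemDn j).2 ⟨by simp [h, hν], by simp [h, isAbs]⟩)
  ------------------------------------------------------------------
  -- (2) the branch `c → μ0`: split off the deeper levels; idle block with `u_d`, all absorbers
  have T1 : (treeMatrix y z).subperm (fun i => Low d i ∧ i ≠ c)
      (fun j => RowQ d c j ∧ j ≠ Sum.inl (nd, μ0)) =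
      pathSub y z μ0 * (z ⟨d, hd⟩ + (levelConst k d : R)) := by
    rw [subperm_split μ0 (by simp [hμ0, hμ]) (fun i => Low d i ∧ i ≠ c)
      (fun j => RowQ d c j ∧ j ≠ Sum.inl (nd, μ0))
      (fun v => vdepth v = d ∧ v ≠ c) (fun v => vdepth v = d ∧ v ≠ c)
      (fun v hv => ⟨show d ≤ vdepth v by omega, fun h => by rw [h, hdc] at hv; omega⟩)
      (fun v hv => low_iff.1 hv.1)
      (fun r hr hne => ⟨hq_of_deep r hr, hne⟩)
      ⟨hqroot, fun h => by rw [← h] at hd0; simp at hd0⟩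
      (fun h => h.2 rfl) (fun r hr hne => hq_le r hr.1 hne)
      (fun v => ⟨fun h => ⟨⟨show d ≤ vdepth v from h.1.ge, h.2⟩, h.1⟩,
        fun h => ⟨h.2, h.1.2⟩⟩)
      (fun r => ⟨fun h => ⟨⟨Or.inl ⟨h.1.ge, h.2⟩, fun h' => by rw [h', hd0] at h; omega⟩, h.1,
        hroot_c r h.1 h.2⟩, fun h => ⟨h.2.1, hq_c r h.1.1 h.2.2⟩⟩),
      subperm_level_eq' d hd _ (fun v hv => hv.1) ⟨hdu, huc⟩
        (fun h => (hroot_c _ h.1 h.2 rfl).elim) ∅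
        (fun v ha hv => by
          simp only [Finset.notMem_empty, not_false_eq_true, iff_true]
          exact ⟨hv, (hne_of_abs v ha).1⟩)
        (by simp), Finset.card_empty, Nat.cast_zero, sub_zero]
  ------------------------------------------------------------------
  -- (3a) the branch `c → m_μ → μ1`: split; idle block with `u_d` and all absorbers but `m_μ`
  have T2a : (treeMatrix y z).subperm (fun i => (Low d i ∧ i ≠ c) ∧ i ≠ m)
      (fun j => (RowQ d c j ∧ j ≠ m) ∧ j ≠ Sum.inl (nd, μ1)) =
      pathSub y z μ1 * (z ⟨d, hd⟩ + (levelConst k d : R) - 1) := by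
    rw [subperm_split μ1 (by simp [hμ1, hμ]) (fun i => (Low d i ∧ i ≠ c) ∧ i ≠ m)
      (fun j => (RowQ d c j ∧ j ≠ m) ∧ j ≠ Sum.inl (nd, μ1))
      (fun v => vdepth v = d ∧ v ≠ c ∧ v ≠ m) (fun v => vdepth v = d ∧ v ≠ c ∧ v ≠ m)
      (fun v hv => ⟨⟨show d ≤ vdepth v by omega, fun h => by rw [h, hdc] at hv; omega⟩,
        fun h => by rw [h, hdm] at hv; omega⟩) (fun v hv => low_iff.1 hv.1.1)
      (fun r hr hne => ⟨⟨hq_of_deep r hr, fun h => by rw [h, hdm] at hr; omega⟩, hne⟩)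
      ⟨⟨hqroot, hroot_m⟩, fun h => by rw [← h] at hd1; simp at hd1⟩
      (fun h => h.2 rfl) (fun r hr hne => hq_le r hr.1.1 hne)
      (fun v => ⟨fun h => ⟨⟨⟨show d ≤ vdepth v from h.1.ge, h.2.1⟩, h.2.2⟩, h.1⟩,
        fun h => ⟨h.2, h.1.1.2, h.1.2⟩⟩)
      (fun r => ⟨fun h => ⟨⟨⟨Or.inl ⟨h.1.ge, h.2.1⟩, h.2.2⟩,
          fun h' => by rw [h', hd1] at h; omega⟩, h.1, hroot_c r h.1 h.2.1⟩,
        fun h => ⟨h.2.1, hq_c r h.1.1.1 h.2.2, h.1.1.2⟩⟩),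
      subperm_level_eq' d hd _ (fun v hv => hv.1) ⟨hdu, huc, hum⟩
        (fun h => (hroot_c _ h.1 h.2.1 rfl).elim) {m}
        (fun v ha hv => by
          simp only [Finset.mem_singleton]
          exact ⟨fun h => h.2.2, fun h => ⟨hv, (hne_of_abs v ha).1, h⟩⟩)
        (fun v hv => by rw [Finset.mem_singleton] at hv; rw [hv]; exact ⟨hm_abs, hdm⟩),
      Finset.card_singleton, Nat.cast_one]
  ------------------------------------------------------------------
  -- (3b) the branch `c → m_μ → u_d`: expand the column `u_d` over the absorbers of depth `d`
  -- the signed path sums of the absorbers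
  let f : V k → R := fun a =>
    match a with
    | Sum.inl (ab, ν) => if h : ν.depth < k then pathSub y z (ν.child true h) else 0
    | Sum.inl (ab', ν) => if h : ν.depth < k then - pathSub y z (ν.child true h) else 0
    | _ => 0
  -- each admissible absorber `a` of depth `d` contributes `f a`
  have hterm : ∀ a ∈ Dn.filter (fun j => (RowQ d c j ∧ j ≠ m) ∧ j ≠ u),
      treeMatrix y z a u * (treeMatrix y z).subperm
        (fun i => ((Low d i ∧ i ≠ c) ∧ i ≠ m) ∧ i ≠ u)
        (fun j => ((RowQ d c j ∧ j ≠ m) ∧ j ≠ u) ∧ j ≠ a) = f a := by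
    intro a ha
    obtain ⟨haD, ⟨⟨-, ham⟩, hau⟩⟩ := Finset.mem_filter.1 ha
    obtain ⟨hda, habs⟩ := (hmemDn a).1 haD
    have hac : a ≠ c := (hne_of_abs a habs).1
    -- `a = m_ν` (`ν ≠ μ`) or `a = m'_ν`, with `ν` of depth `d`
    obtain ⟨κ, ν, hκ, rfl⟩ : ∃ κ ν, (κ = ab ∨ κ = ab') ∧ a = Sum.inl (κ, ν) := by
      rcases a with ⟨κ, ν⟩ | i
      · rcases κ with _ | _ | _
        · simp [isAbs] at habs
        · exact ⟨ab, ν, Or.inl rfl, rfl⟩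
        · exact ⟨ab', ν, Or.inr rfl, rfl⟩
      · simp [isAbs] at habs
    have hνd : ν.depth = d := by simpa using hda
    have hνk : ν.depth < k := hνd ▸ hd
    set ν1 := ν.child true hνk with hν1
    set a : V k := Sum.inl (κ, ν) with ha_def
    have hν1d : ν1.depth = d + 1 := by simp [hν1, hνd]
    have hdn1 : vdepth (Sum.inl (nd, ν1) : V k) = d + 1 := by simp [hν1, hνd]
    have hn1m : (Sum.inl (nd, ν1) : V k) ≠ m := by simp [hm]
    have hn1u : (Sum.inl (nd, ν1) : V k) ≠ u := by simp [hu]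
    have hn1a : (Sum.inl (nd, ν1) : V k) ≠ a := fun h => by
      have := congrArg vdepth h; rw [hdn1, hda] at this; omega
    have hroot_a : (Sum.inl (nd, root) : V k) ≠ a := fun h => by
      rw [← h] at habs; simp [isAbs] at habs
    -- the value of `f a` and the two entries at `a`
    have hf : f a = treeMatrix y z (Sum.inl (nd, ν1)) a * pathSub y z ν1 := by
      rw [treeMatrix_apply]
      rcases hκ with rfl | rfl
      · simp only [f, ha_def, dif_pos hνk, hν1, wt_ab_child hνk, one_mul]
      · simp only [f, ha_def, dif_pos hνk, hν1, wt_ab'_child hνk, neg_mul, one_mul]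
    have hua : treeMatrix y z a u = 1 := by
      rw [treeMatrix_apply, hu, ha_def]
      rcases hκ with rfl | rfl
      · exact wt_u_ab hνd
      · exact wt_u_ab' hνd
    -- no other successor of `a`
    have hz_a : ∀ r', (((RowQ d c r' ∧ r' ≠ m) ∧ r' ≠ u) ∧ r' ≠ a) →
        r' ≠ Sum.inl (nd, ν1) → treeMatrix y z r' a = 0 := by
      intro r' hr' hne
      rw [treeMatrix_apply]
      by_contra hw
      have hr'u : r' ≠ u := hr'.1.2
      have hw' := hw
      rw [ha_def] at hw'
      rcases hκ with rfl | rfl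
      · rcases wt_ab_ne_zero hw' with h | ⟨hν, h⟩ | ⟨i, h, hi⟩
        · exact hr'.2 (h.trans ha_def.symm)
        · exact hne (by rw [h, hν1])
        · apply hr'u; rw [h, hu]; congr; exact Fin.ext (hνd.symm.trans hi).symm
      · rcases wt_ab'_ne_zero hw' with h | ⟨hν, h⟩ | ⟨i, h, hi⟩
        · exact hr'.2 (h.trans ha_def.symm)
        · exact hne (by rw [h, hν1])
        · apply hr'u; rw [h, hu]; congr; exact Fin.ext (hνd.symm.trans hi).symm
    -- the idle block after `u_d → a → ν1`: neither `u_d` nor the root, so it is `1`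
    have hidle : (treeMatrix y z).subperm
        (fun v => vdepth v = d ∧ v ≠ c ∧ v ≠ m ∧ v ≠ u ∧ v ≠ a)
        (fun v => vdepth v = d ∧ v ≠ c ∧ v ≠ m ∧ v ≠ u ∧ v ≠ a) = 1 :=
      subperm_level_eq_one d _ _ (fun _ => Iff.rfl) (fun v hv => hv.1)
        (fun i hi => hi.2.2.2.1 (by
          have : (i : ℕ) = d := by simpa using hi.1
          rw [hu]; congr 1; exact Fin.ext this))
        (fun h => (hroot_c _ h.1 h.2.1 rfl).elim)
    rw [hf, hua, one_mul, (treeMatrix y z).subperm_col_one a (Sum.inl (nd, ν1))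
      ⟨⟨⟨show Low d a by rw [low_iff]; omega, hac⟩, ham⟩, hau⟩
      ⟨⟨⟨hq_of_deep _ (by omega), hn1m⟩, hn1u⟩, hn1a⟩ hz_a,
      subperm_split ν1 hν1d
      (fun i => (((Low d i ∧ i ≠ c) ∧ i ≠ m) ∧ i ≠ u) ∧ i ≠ a)
      (fun j => (((RowQ d c j ∧ j ≠ m) ∧ j ≠ u) ∧ j ≠ a) ∧ j ≠ Sum.inl (nd, ν1))
      (fun v => vdepth v = d ∧ v ≠ c ∧ v ≠ m ∧ v ≠ u ∧ v ≠ a)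
      (fun v => vdepth v = d ∧ v ≠ c ∧ v ≠ m ∧ v ≠ u ∧ v ≠ a)
      (fun v hv => ⟨⟨⟨⟨show d ≤ vdepth v by omega, fun h => by rw [h, hdc] at hv; omega⟩,
        fun h => by rw [h, hdm] at hv; omega⟩, fun h => by rw [h, hdu] at hv; omega⟩,
        fun h => by rw [h, hda] at hv; omega⟩)
      (fun v hv => low_iff.1 hv.1.1.1.1)
      (fun r hr hne => ⟨⟨⟨⟨hq_of_deep r hr, fun h => by rw [h, hdm] at hr; omega⟩,
        fun h => by rw [h, hdu] at hr; omega⟩, fun h => by rw [h, hda] at hr; omega⟩, hne⟩)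
      ⟨⟨⟨⟨hqroot, hroot_m⟩, hroot_u⟩, hroot_a⟩, fun h => by rw [← h] at hdn1; simp at hdn1⟩
      (fun h => h.2 rfl) (fun r hr hne' => hq_le r hr.1.1.1.1 hne')
      (fun v => ⟨fun h => ⟨⟨⟨⟨⟨show d ≤ vdepth v from h.1.ge, h.2.1⟩, h.2.2.1⟩, h.2.2.2.1⟩,
          h.2.2.2.2⟩, h.1⟩,
        fun h => ⟨h.2, h.1.1.1.1.2, h.1.1.1.2, h.1.1.2, h.1.2⟩⟩)
      (fun r => ⟨fun h => ⟨⟨⟨⟨⟨Or.inl ⟨h.1.ge, h.2.1⟩, h.2.2.1⟩, h.2.2.2.1⟩, h.2.2.2.2⟩,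
          fun h' => by rw [h', hdn1] at h; omega⟩, h.1, hroot_c r h.1 h.2.1⟩,
        fun h => ⟨h.2.1, hq_c r h.1.1.1.1.1 h.2.2, h.1.1.1.1.2, h.1.1.1.2, h.1.1.2⟩⟩),
      hidle, mul_one]
  have T2b : (treeMatrix y z).subperm (fun i => (Low d i ∧ i ≠ c) ∧ i ≠ m)
      (fun j => (RowQ d c j ∧ j ≠ m) ∧ j ≠ u) = - pathSub y z μ1 := by
    rw [(treeMatrix y z).subperm_expand_col_support u
      ⟨⟨show Low d u by rw [low_iff]; omega, huc⟩, hum⟩ Dn hz_u, Finset.sum_congr rfl hterm]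
    -- the admissible absorbers are all of `Dn` but `m_μ`
    have hfilter : Dn.filter (fun j => (RowQ d c j ∧ j ≠ m) ∧ j ≠ u) = Dn.erase m := by
      ext a
      rw [Finset.mem_filter, Finset.mem_erase, hmemDn]
      constructor
      · rintro ⟨h, ⟨-, ham⟩, -⟩; exact ⟨ham, h⟩
      · rintro ⟨ham, hda, habs⟩
        exact ⟨⟨hda, habs⟩, ⟨Or.inl ⟨hda.ge, (hne_of_abs a habs).1⟩, ham⟩, (hne_of_abs a habs).2⟩
    rw [hfilter, Finset.sum_erase_eq_sub hmDn]
    -- pairing `m_ν` with `m'_ν`: the sum over all absorbers of depth `d` vanishes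
    have hpair : ∑ a ∈ Dn, f a = 0 := by
      have hDn2 : Dn = (univ.filter fun ν : Node k => ν.depth = d).map
          ⟨fun ν => (Sum.inl (ab, ν) : V k), fun a b h => by simpa using h⟩ ∪
          (univ.filter fun ν : Node k => ν.depth = d).map
          ⟨fun ν => (Sum.inl (ab', ν) : V k), fun a b h => by simpa using h⟩ := by
        ext v
        rw [hmemDn, Finset.mem_union, Finset.mem_map, Finset.mem_map]
        constructor
        · rintro ⟨hv, habs⟩
          rcases v with ⟨κ, ν⟩ | i
          · rcases κ with _ | _ | _
            · simp [isAbs] at habs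
            · exact Or.inl ⟨ν, by simpa using hv, rfl⟩
            · exact Or.inr ⟨ν, by simpa using hv, rfl⟩
          · simp [isAbs] at habs
        · rintro (⟨ν, hν, rfl⟩ | ⟨ν, hν, rfl⟩)
          · exact ⟨by simpa using hν, by simp [isAbs]⟩
          · exact ⟨by simpa using hν, by simp [isAbs]⟩
      rw [hDn2, Finset.sum_union, Finset.sum_map, Finset.sum_map, ← Finset.sum_add_distrib]
      · refine Finset.sum_eq_zero fun ν hν => ?_
        have hνk : ν.depth < k := by have := (Finset.mem_filter.1 hν).2; omega
        simp only [f, Function.Embedding.coeFn_mk, dif_pos hνk]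
        ring
      · rw [Finset.disjoint_left]
        rintro v h1 h2
        obtain ⟨ν, -, rfl⟩ := Finset.mem_map.1 h1
        obtain ⟨ν', -, h⟩ := Finset.mem_map.1 h2
        simp at h
    have hfm : f m = pathSub y z μ1 := by
      simp only [f, hm, dif_pos hμk, hμ1]
    rw [hpair, zero_sub]
    show -(f m) = -(pathSub y z μ1)
    rw [hfm]
  ------------------------------------------------------------------
  -- (1) expand the column `c` (successor `μ0` or `m_μ`), then the column `m_μ` (`μ1` or `u_d`)
  have hpath : pathSub y z μ = (treeMatrix y z).subperm (Low d) (RowQ d c) := by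
    unfold pathSub; rw [hμ]
  rw [hpath, (treeMatrix y z).subperm_col_two c (Sum.inl (nd, μ0)) m
    (show Low d c by rw [low_iff]; omega)
    (Or.inl ⟨by omega, h0c⟩) (Or.inl ⟨by omega, hmc⟩) h0m hz_c, e_c0, e_cm,
    one_mul, one_mul, T1,
    (treeMatrix y z).subperm_col_two m (Sum.inl (nd, μ1)) u
    ⟨show Low d m by rw [low_iff]; omega, hmc⟩
    ⟨hq_of_deep _ (by omega), h1m⟩ ⟨Or.inl ⟨by omega, huc⟩, hum⟩ h1u
    hz_m, e_m1, e_mu, one_mul, one_mul, T2a, T2b]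
  ring

/-! ### The closed formula -/

/-- The assignments extending the bit string of `μ` (the leaves below `μ`). [folklore] -/
def extSet (μ : Node k) : Finset (Fin k → Bool) :=
  univ.filter fun g => ∀ t : Fin k, (t : ℕ) < μ.depth → g t = μ.bits t

/-- Membership in `extSet`. [folklore] -/
theorem mem_extSet {μ : Node k} {g : Fin k → Bool} :
    g ∈ extSet μ ↔ ∀ t : Fin k, (t : ℕ) < μ.depth → g t = μ.bits t := by
  simp [extSet]

/-- Only the leaf itself extends a leaf. [folklore] -/
theorem extSet_leaf {μ : Node k} (hμ : μ.depth = k) : extSet μ = {μ.bits} := by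
  ext g
  rw [mem_extSet, Finset.mem_singleton]
  constructor
  · intro h; funext t; exact h t (by rw [hμ]; exact t.2)
  · rintro rfl t _; rfl

/-- The extensions of a child are the extensions of the parent with the new bit prescribed. [folklore] -/
theorem mem_extSet_child {μ : Node k} (hμ : μ.depth < k) {b : Bool} {g : Fin k → Bool} :
    g ∈ extSet (μ.child b hμ) ↔ g ∈ extSet μ ∧ g ⟨μ.depth, hμ⟩ = b := by
  rw [mem_extSet, mem_extSet]
  constructor
  · intro h
    refine ⟨fun t ht => ?_, ?_⟩
    · rw [h t (by simp; omega), bits_child_of_lt _ _ _ _ ht]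
    · rw [h ⟨μ.depth, hμ⟩ (by simp), bits_child_self]
  · rintro ⟨h1, h2⟩ t ht
    simp only [depth_child] at ht
    rcases Nat.lt_succ_iff_lt_or_eq.1 ht with ht | ht
    · rw [h1 t ht, bits_child_of_lt _ _ _ _ ht]
    · have : t = ⟨μ.depth, hμ⟩ := Fin.ext ht
      subst this
      rw [h2, bits_child_self]

/-- Every assignment extends the root. [folklore] -/
theorem extSet_root : extSet (root : Node k) = univ := by
  ext g; simp [mem_extSet]

/-- The factor contributed by the levels `≥ d` to the leaf `g`. [folklore] -/
def levelProd (z : Fin k → R) (g : Fin k → Bool) (d : ℕ) : R :=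
  ∏ i ∈ univ.filter (fun i : Fin k => d ≤ (i : ℕ)),
    (z i + (levelConst k i : R) - 2 * (if g i then 1 else 0))

/-- The empty level product. [folklore] -/
theorem levelProd_of_le {g : Fin k → Bool} {d : ℕ} (hd : k ≤ d) : levelProd z g d = 1 := by
  unfold levelProd
  rw [Finset.filter_false_of_mem (fun i _ => by omega), Finset.prod_empty]

/-- Splitting off the factor of level `d` from the level product. [folklore] -/
theorem levelProd_succ {g : Fin k → Bool} {d : ℕ} (hd : d < k) :
    levelProd z g d = (z ⟨d, hd⟩ + (levelConst k d : R) - 2 * (if g ⟨d, hd⟩ then 1 else 0)) *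
      levelProd z g (d + 1) := by
  unfold levelProd
  have : (univ.filter fun i : Fin k => d ≤ (i : ℕ)) =
      insert ⟨d, hd⟩ (univ.filter fun i : Fin k => d + 1 ≤ (i : ℕ)) := by
    ext i
    simp only [Finset.mem_filter, Finset.mem_univ, true_and, Finset.mem_insert, Fin.ext_iff]
    omega
  rw [this, Finset.prod_insert (by simp)]

/-- **The path sums in closed form**: `S(μ) = ∑_{g ⊒ μ} y_g ∏_{i ≥ depth μ} (z_i + K_i - 2 g_i)`,
by decreasing induction on the depth from the leaves (`pathSub_leaf`) with the recursion
`pathSub_step`. [cite: HrubesJoglekar2025, Thm. 3 (p. 53:4)] -/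
theorem pathSub_eq (μ : Node k) :
    pathSub y z μ = ∑ g ∈ extSet μ, y g * levelProd z g μ.depth := by
  -- induction on `e = k - depth μ`
  suffices h : ∀ e (μ : Node k), μ.depth + e = k →
      pathSub y z μ = ∑ g ∈ extSet μ, y g * levelProd z g μ.depth by
    exact h (k - μ.depth) μ (by have := μ.depth_le; omega)
  intro e
  induction e with
  | zero =>
    intro μ hμ
    rw [add_zero] at hμ
    rw [pathSub_leaf μ hμ, extSet_leaf hμ, Finset.sum_singleton, hμ, levelProd_of_le le_rfl, mul_one]
  | succ e ih =>
    intro μ hμ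
    have hd : μ.depth < k := by omega
    rw [pathSub_step μ rfl hd, ih _ (by simp; omega), ih _ (by simp; omega)]
    simp only [depth_child]
    -- split the sum over the extensions of `μ` according to the bit at position `depth μ`
    have hsplit : extSet μ = extSet (μ.child false hd) ∪ extSet (μ.child true hd) := by
      ext g
      rw [Finset.mem_union, mem_extSet_child, mem_extSet_child]
      cases g ⟨μ.depth, hd⟩ <;> simp
    have hdisj : Disjoint (extSet (μ.child false hd)) (extSet (μ.child true hd)) := by
      rw [Finset.disjoint_left]
      intro g h1 h2
      rw [mem_extSet_child] at h1 h2
      rw [h1.2] at h2; exact Bool.noConfusion h2.2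
    rw [hsplit, Finset.sum_union hdisj, Finset.sum_mul, Finset.sum_mul]
    congr 1
    · refine Finset.sum_congr rfl fun g hg => ?_
      rw [levelProd_succ hd, ((mem_extSet_child hd).1 hg).2]
      simp only [Bool.false_eq_true, if_false, mul_zero, sub_zero]
      ring
    · refine Finset.sum_congr rfl fun g hg => ?_
      rw [levelProd_succ hd, ((mem_extSet_child hd).1 hg).2]
      simp only [if_true, mul_one]
      ring

/-- **The permanent of the gadget** (replacing Hrubeš–Joglekar 2025, Thm. 3, for the purposes of
Thm. 7): `per (treeMatrix y z) = ∑_{g ∈ {0,1}^k} y_g ∏_{i<k} (z_i + K_i - 2 g_i)` with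
`K_i = levelConst k i` the number of absorbers of depth `i`. Each variable `z_i` occurs exactly
once (the loop at `u_i`), each `y_g` exactly once (the edge from the leaf `g` to the root).
[cite: HrubesJoglekar2025, Thm. 3 (p. 53:4)] -/
theorem permanent_treeMatrix (y : (Fin k → Bool) → R) (z : Fin k → R) :
    (treeMatrix y z).permanent = ∑ g : Fin k → Bool, y g * levelProd z g 0 := by
  rw [← (treeMatrix y z).subperm_true, (treeMatrix y z).subperm_congr
    (p' := Low (root : Node k).depth) (q' := RowQ (root : Node k).depth (Sum.inl (nd, root)))
    (fun v => by rw [low_iff]; simp) (fun r => by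
      rw [rowQ_iff, depth_root]
      simp only [Nat.zero_le, true_and, true_iff]
      exact (em (r = Sum.inl (nd, root))).elim Or.inr Or.inl)]
  change pathSub y z root = _
  rw [pathSub_eq, extSet_root, depth_root]

end Path

end Weights

/-! ### The permanent as a polynomial in `z`, and prescribing its coefficients -/

section Poly

open Kind Node MvPolynomial

variable {R : Type*} [CommRing R]

/-- The `2 × 2` blocks of the coefficient matrix: the factor of level `i` in the coefficient of
the monomial with indicator `s` at the leaf `g` is `1` if `z_i` is taken (`s = true`) and
`K_i - 2 g_i` otherwise. [folklore] -/
def coefBlock (K : R) (s b : Bool) : R := if s then 1 else K - 2 * (if b then 1 else 0)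

/-- The inverse blocks (they need `2` to be invertible: `det (coefBlock K) = 2`). [folklore] -/
def invBlock [Invertible (2 : R)] (K : R) (b s : Bool) : R :=
  ⅟(2 : R) * (if b then (if s then K else -1) else (if s then -(K - 2) else 1))

/-- `coefBlock K · invBlock K = 1` (a `2 × 2` matrix identity; this is where `2` must be a
unit). [folklore] -/
theorem sum_coefBlock_mul_invBlock [Invertible (2 : R)] (K : R) (s s' : Bool) :
    ∑ b : Bool, coefBlock K s b * invBlock K b s' = if s = s' then 1 else 0 := by
  have h2 : (2 : R) * ⅟(2 : R) = 1 := mul_invOf_self _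
  rw [Fintype.sum_bool]
  cases s <;> cases s' <;>
    simp only [coefBlock, invBlock, if_true, if_false, Bool.false_eq_true, Bool.true_eq_false]
  · linear_combination h2
  · ring
  · ring
  · linear_combination h2

/-- **The permanent of the gadget as a polynomial in the `z`-variables**: with constant weights
`y_g ∈ R` and `z_i = X_i`, `per (treeMatrix) = ∑_s C(∑_g y_g ∏_i coefBlock K_i s_i g_i) · X^s`,
the sum over the indicators `s` of the multilinear monomials `X^s = ∏_{s_i} X_i`.
[cite: HrubesJoglekar2025, Thm. 3 (p. 53:4)] -/
theorem permanent_treeMatrix_C_X (yv : (Fin k → Bool) → R) :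
    (treeMatrix (fun g => C (yv g)) X : Matrix (V k) (V k) (MvPolynomial (Fin k) R)).permanent =
      ∑ s : Fin k → Bool, C (∑ g : Fin k → Bool, yv g *
        ∏ i : Fin k, coefBlock (levelConst k i : R) (s i) (g i)) *
        ∏ i : Fin k, (if s i then X i else 1) := by
  rw [permanent_treeMatrix]
  -- expand each product `∏_i (X_i + C a_{g,i})` over the indicators `s`
  have hexp : ∀ g : Fin k → Bool, levelProd X g 0 =
      ∑ s : Fin k → Bool, (∏ i, (if s i then (1 : MvPolynomial (Fin k) R)
        else C (coefBlock (levelConst k i : R) false (g i)))) * ∏ i, (if s i then X i else 1) := by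
    intro g
    unfold levelProd
    rw [Finset.filter_true_of_mem (fun i _ => Nat.zero_le _)]
    have : ∀ i : Fin k, (X i + (levelConst k i : MvPolynomial (Fin k) R) -
        2 * (if g i then 1 else 0)) = ∑ b : Bool, (if b then X i
          else C (coefBlock (levelConst k i : R) false (g i))) := fun i => by
      rw [Fintype.sum_bool, if_pos rfl, if_neg Bool.false_ne_true]
      simp only [coefBlock, Bool.false_eq_true, if_false, map_sub, map_natCast, map_mul,
        apply_ite C, map_one, map_zero, map_ofNat]
      rw [add_sub_assoc]
    simp_rw [this]
    rw [Fintype.prod_sum]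
    refine Finset.sum_congr rfl fun s _ => ?_
    rw [← Finset.prod_mul_distrib]
    refine Finset.prod_congr rfl fun i _ => ?_
    cases s i <;> simp
  simp_rw [hexp, Finset.mul_sum]
  rw [Finset.sum_comm]
  refine Finset.sum_congr rfl fun s _ => ?_
  rw [map_sum, Finset.sum_mul]
  refine Finset.sum_congr rfl fun g _ => ?_
  rw [map_mul, map_prod, ← mul_assoc]
  congr 2
  refine Finset.prod_congr rfl fun i _ => ?_
  cases s i <;> simp [coefBlock]

/-- **Prescribing all `2^k` coefficients** (replacing Hrubeš–Joglekar 2025, Thm. 3 / footnote 3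
in the proof of Thm. 7): if `2` is invertible in `R`, then for every family of coefficients
`c_s ∈ R` there are weights `y_g ∈ R` such that the permanent of the gadget — a matrix over
`R ∪ {X_0, …, X_{k-1}}` in which each `X_i` occurs exactly once, on the diagonal — is the
multilinear polynomial `∑_s c_s X^s`. [cite: HrubesJoglekar2025, Thm. 3 (p. 53:4)] -/
theorem exists_permanent_treeMatrix_eq [Invertible (2 : R)] (c : (Fin k → Bool) → R) :
    ∃ yv : (Fin k → Bool) → R,
      (treeMatrix (fun g => C (yv g)) X : Matrix (V k) (V k) (MvPolynomial (Fin k) R)).permanent =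
        ∑ s : Fin k → Bool, C (c s) * ∏ i : Fin k, (if s i then X i else 1) := by
  refine ⟨fun g => ∑ s : Fin k → Bool,
    (∏ i : Fin k, invBlock (levelConst k i : R) (g i) (s i)) * c s, ?_⟩
  rw [permanent_treeMatrix_C_X]
  refine Finset.sum_congr rfl fun s _ => ?_
  congr 2
  -- `∑_g (∑_{s'} (∏ inv) c_{s'}) ∏ coef = c_s`
  calc ∑ g : Fin k → Bool, (∑ s' : Fin k → Bool,
        (∏ i : Fin k, invBlock (levelConst k i : R) (g i) (s' i)) * c s') *
        ∏ i : Fin k, coefBlock (levelConst k i : R) (s i) (g i)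
      = ∑ s' : Fin k → Bool, c s' * ∑ g : Fin k → Bool,
          ∏ i : Fin k, (coefBlock (levelConst k i : R) (s i) (g i) *
          invBlock (levelConst k i : R) (g i) (s' i)) := by
        simp_rw [Finset.sum_mul, Finset.prod_mul_distrib]
        rw [Finset.sum_comm]
        refine Finset.sum_congr rfl fun s' _ => ?_
        rw [Finset.mul_sum]
        refine Finset.sum_congr rfl fun g _ => ?_
        ring
    _ = ∑ s' : Fin k → Bool, c s' * ∏ i : Fin k, (if s i = s' i then (1 : R) else 0) := by
        refine Finset.sum_congr rfl fun s' _ => ?_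
        congr 1
        rw [← Fintype.prod_sum fun (i : Fin k) b => coefBlock (levelConst k i : R) (s i) b *
          invBlock (levelConst k i : R) b (s' i)]
        exact Finset.prod_congr rfl fun i _ => sum_coefBlock_mul_invBlock _ _ _
    _ = ∑ s' : Fin k → Bool, c s' * (if s = s' then 1 else 0) := by
        refine Finset.sum_congr rfl fun s' _ => ?_
        congr 1
        split_ifs with h
        · exact Finset.prod_eq_one fun i _ => by rw [if_pos (congrFun h i)]
        · obtain ⟨i, hi⟩ : ∃ i, s i ≠ s' i := by
            by_contra hne; push Not at hne; exact h (funext hne)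
          exact Finset.prod_eq_zero (Finset.mem_univ i) (if_neg hi)
    _ = c s := by simp

end Poly

end ReadOnceTree

end Literature.Computability.AlgebraicComplexity
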